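import Literature.Claims.NS.Balawi2025
import Literature.Analysis.FluidPDE.TorusClassicalLerayHopfProofs
import HarnessLib

/-!
# Solo salvage for claim C155 `Balawi2025` (cell `ns-claims`, D-0090): the energy step of Cor 7.4
# at the grain where the skeleton's dissipation integral is honest

Claim C155: Balawi, «Global Regularity for 3D Navier–Stokes via Dyadic Shape, UV Front Barrier, and
Windowed Duhamel–Grönwall» (Zenodo 17298965, V5, 33 pp.); skeleton `Literature.Claims.NS.Balawi2025`
(typist-5 g6, p527666). The proof of Cor 7.4 p.22 ends «… = ∫₀ᵀ‖∇u(t)‖²_{L²} dt ≤ (1/2ν)‖u₀‖²_{L²}, by the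
energy inequality (1.4)». The skeleton's dissipation integral `dissT u 0 T = ∫⁻_{(0,T)} ofReal ‖∇u(t)‖₂²`
is computed with the CLASSICAL gradient of the representative (`Torus.gradNormSq`), which is the honest
quantity exactly on the classical members of the printed Leray–Hopf class (the binders of
`Step74sum_T3_classical`). This file records the TRUE energy step there:

* `integral_gradNormSq_le` — for a classical solution of the unforced system on `[0,∞) × 𝕋³` with
  `ν > 0`: `∫₀ᵀ ‖∇u‖₂² ≤ E(u(0))/ν`, `E = ½‖·‖₂²` (the tree's energy EQUALITY
  `Torus.IsClassicalNSSolutionOn.energy_eq`, Robinson–Rodrigo–Sadowski Thm 6.5, and `E(u(T)) ≥ 0`);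
* `dissT_eq_ofReal_integral`, `dissT_le_of_classical`, `dissT_lt_top_of_classical` — the same for the
  skeleton's extended-real `dissT` (continuity of `t ↦ ‖∇u(t)‖₂²` identifies the Lebesgue integral);
* `bkmT_le_energy_of_step74sum_T3_classical` — the end-to-end display of Cor 7.4 GIVEN the summed
  window bound (7.4) on classical members (a hypothesis here — disputed in the cell, never asserted):
  `∫₀ᵀ‖ω‖_∞ ≤ C · E(u(0))/ν` with the profile-and-`ν`-only constant `C` of the hypothesis — the
  amplitude-degree-1 ≤ degree-2 face made explicit (left side linear, right side quadratic in the datum);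
* `cor74_T3_classical_of_step74sum` — Cor 7.4's conclusion (BKM finiteness on every `[0,T]`) for the
  classical members, by the skeleton's own arithmetic `bkm_lt_top_of_step74sum_T3`-style step.

TRUE mathematics only; salvage seat `ns-claims-salvage-p5` g4. Solo lane (no item).

WHAT THIS IS NOT: not a claim about NS regularity or blow-up; not a claim about any author beyond the
typed locator.
-/

-- lint debt (one line): the Theorems namespace repeats the summit name by the D-0017 layout.
set_option linter.dupNamespace false

noncomputable section

open Set Filter MeasureTheory Topology
open scoped ENNReal NNReal RealInnerProductSpace

namespace Summit.NavierStokesRegularity.NavierStokesRegularity.Theorems.Balawi2025Salvage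

open Literature.Analysis.FunctionSpaces Literature.Analysis.FluidPDE
open Literature.Claims.NS.Balawi2025

variable {ν T : ℝ} {u : ℝ → T3 → E3} {p : ℝ → T3 → ℝ}

/-! ## The energy step «∫₀ᵀ‖∇u‖²₂ ≤ ‖u₀‖²₂/(2ν)» for classical solutions on `[0,∞) × 𝕋³` -/

/-- `t ↦ ‖∇u(t)‖₂²` is continuous on `[0,∞)` along a classical solution there. [folklore] -/
theorem continuousOn_gradNormSq (h : Torus.IsClassicalNSSolutionOn (Ici 0) ν 0 u p) :
    ContinuousOn (fun t => Torus.gradNormSq (u t)) (Ici 0) :=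
  h.smooth_velocity.continuousOn_gradNormSq (convex_Ici 0) (uniqueDiffOn_Ici 0)

/-- **The printed energy step (Cor 7.4 p.22 l.80–85, via (1.4) p.4) for classical solutions**: along a
classical solution of the unforced Navier–Stokes system on `[0,∞) × 𝕋³` with `ν > 0`,
`∫₀ᵀ ‖∇u(t)‖₂² dt ≤ E(u(0))/ν`, `E = ½‖·‖₂²` — from the energy equality and `E(u(T)) ≥ 0`.
[cite: Balawi2025, Cor 7.4 proof p.22; (1.4) p.4] [cite: RobinsonRodrigoSadowski2016, Thm. 6.5] -/
theorem integral_gradNormSq_le (h : Torus.IsClassicalNSSolutionOn (Ici 0) ν 0 u p) (hν : 0 < ν)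
    (hT : 0 ≤ T) :
    ∫ t in (0:ℝ)..T, Torus.gradNormSq (u t) ≤ Torus.kineticEnergy (u 0) / ν := by
  have hE := h.energy_eq (convex_Ici 0) hT (fun t ht => (ht.1 : 0 ≤ t))
  simp only [Pi.zero_apply, inner_zero_left, integral_zero, intervalIntegral.integral_zero,
    add_zero] at hE
  have hET : 0 ≤ Torus.kineticEnergy (u T) := Torus.kineticEnergy_nonneg _
  rw [le_div_iff₀ hν]
  linarith

/-- The dissipation integral on `[0,T]` of a classical solution is nonnegative. [folklore] -/
theorem integral_gradNormSq_nonneg (hT : 0 ≤ T) :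
    0 ≤ ∫ t in (0:ℝ)..T, Torus.gradNormSq (u t) :=
  intervalIntegral.integral_nonneg hT fun _ _ => Torus.gradNormSq_nonneg _

/-- **The skeleton's `dissT` is the classical dissipation integral on classical solutions**:
`dissT u 0 T = ofReal (∫₀ᵀ ‖∇u(t)‖₂² dt)` (the integrand is continuous on `[0,T]`, hence integrable,
and nonnegative). [folklore] -/
theorem dissT_eq_ofReal_integral (h : Torus.IsClassicalNSSolutionOn (Ici 0) ν 0 u p) (hT : 0 < T) :
    dissT u 0 T = ENNReal.ofReal (∫ t in (0:ℝ)..T, Torus.gradNormSq (u t)) := by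
  have hcont : ContinuousOn (fun t => Torus.gradNormSq (u t)) (Icc 0 T) :=
    (continuousOn_gradNormSq h).mono fun t ht => (ht.1 : 0 ≤ t)
  have hint : IntegrableOn (fun t => Torus.gradNormSq (u t)) (Ioo 0 T) volume :=
    (hcont.integrableOn_compact isCompact_Icc).mono_set Ioo_subset_Icc_self
  unfold dissT
  rw [intervalIntegral.integral_of_le hT.le, integral_Ioc_eq_integral_Ioo,
    ofReal_integral_eq_lintegral_ofReal hint
      (ae_of_all _ fun t => Torus.gradNormSq_nonneg (u t))]

/-- **`dissT ≤ E(u(0))/ν` on classical members** — the energy step in the skeleton's extended-real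
vocabulary. [cite: Balawi2025, Cor 7.4 proof p.22; (1.4) p.4] -/
theorem dissT_le_of_classical (h : Torus.IsClassicalNSSolutionOn (Ici 0) ν 0 u p) (hν : 0 < ν)
    (hT : 0 < T) : dissT u 0 T ≤ ENNReal.ofReal (Torus.kineticEnergy (u 0) / ν) := by
  rw [dissT_eq_ofReal_integral h hT]
  exact ENNReal.ofReal_le_ofReal (integral_gradNormSq_le h hν hT.le)

/-- In particular the dissipation integral of a classical member is finite (the finiteness Cor 7.4
consumes: «Hence the BKM integral is finite»). [cite: Balawi2025, Cor 7.4 proof p.22] -/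
theorem dissT_lt_top_of_classical (h : Torus.IsClassicalNSSolutionOn (Ici 0) ν 0 u p) (hν : 0 < ν)
    (hT : 0 < T) : dissT u 0 T < ⊤ :=
  lt_of_le_of_lt (dissT_le_of_classical h hν hT) ENNReal.ofReal_lt_top

/-! ## Cor 7.4 end to end on classical members, GIVEN the summed window bound -/

/-- **Cor 7.4's display end to end, GIVEN (7.4) summed over windows on classical members** (p.22:
«∫₀ᵀ‖ω‖_∞ ≲ Σ_windows ∫‖∇u‖²₂ = ∫₀ᵀ‖∇u‖²₂ ≤ ‖u₀‖²₂/(2ν)»): under `Step74sum_T3_classical ν` (a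
hypothesis — disputed in the cell, never asserted) there is a constant `C` (the profile-and-`ν`-only
constant of the hypothesis) with `∫₀ᵀ‖ω‖_{L∞} ≤ C · E(u(0))/ν` for every classical global Leray–Hopf
solution and every `T > 0` — left side of amplitude degree 1, right side of degree 2 in the datum.
[cite: Balawi2025, Cor 7.4 proof p.22; Thm 2.1 p.7; Remark 2.2 p.7] -/
theorem bkmT_le_energy_of_step74sum_T3_classical (h74 : Step74sum_T3_classical ν) (hν : 0 < ν) :
    ∃ C : ℝ≥0, ∀ (u : ℝ → T3 → E3) (p : ℝ → T3 → ℝ), MemLp (u 0) 2 volume →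
      Torus.IsWeaklyDivFree (u 0) → Torus.IsGlobalLerayHopf ν 0 (u 0) u →
      Torus.IsClassicalNSSolutionOn (Ici 0) ν 0 u p →
        ∀ T : ℝ, 0 < T → bkmT u 0 T ≤ C * ENNReal.ofReal (Torus.kineticEnergy (u 0) / ν) := by
  obtain ⟨C, hC⟩ := h74 hν
  refine ⟨C, fun u p h0 hdiv hLH hcl T hT => (hC u p h0 hdiv hLH hcl T hT).trans ?_⟩
  exact mul_le_mul' le_rfl (dissT_le_of_classical hcl hν hT)

/-- **Cor 7.4 for classical members, GIVEN the summed window bound**: BKM finiteness on every `[0,T]`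
(the skeleton's arithmetic «C · finite < ⊤» with the finiteness supplied by `dissT_lt_top_of_classical`).
[cite: Balawi2025, Cor 7.4 p.22] -/
theorem cor74_T3_classical_of_step74sum (h74 : Step74sum_T3_classical ν) (hν : 0 < ν)
    {u : ℝ → T3 → E3} {p : ℝ → T3 → ℝ} (h0 : MemLp (u 0) 2 volume) (hdiv : Torus.IsWeaklyDivFree (u 0))
    (hLH : Torus.IsGlobalLerayHopf ν 0 (u 0) u) (hcl : Torus.IsClassicalNSSolutionOn (Ici 0) ν 0 u p)
    (hT : 0 < T) : bkmT u 0 T < ⊤ := by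
  obtain ⟨C, hC⟩ := h74 hν
  exact lt_of_le_of_lt (hC u p h0 hdiv hLH hcl T hT)
    (ENNReal.mul_lt_top ENNReal.coe_lt_top (dissT_lt_top_of_classical hcl hν hT))

end Summit.NavierStokesRegularity.NavierStokesRegularity.Theorems.Balawi2025Salvage

end

-- WHAT THIS IS NOT: not a claim about NS regularity or blow-up; not a claim about any author beyond the
-- typed locator.
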